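import Literature.Geometry.Kaehler.ComplexTorusEllipticSelfProductConeOfCurves
import Literature.Geometry.Kaehler.ComplexTorusAbelianSurfaceConeOfCurvesRationalRays
import Literature.Geometry.Kaehler.ComplexTorusAmpleConeNefConeInterior
import Literature.Geometry.Kaehler.ComplexTorusEllipticCurveAutomorphisms
import HarnessLib

/-!
# The ample cone of `E × E`: `𝒪(a₁F₁ + a₂F₂ + a₃Δ)` is ample iff `a₁ + a₂, a₂ + a₃, a₃ + a₁, a₁a₂ + a₂a₃ + a₃a₁ > 0`
# (Bauer–Schulz (2.0.1)); the open positive cone `Q⁺` of an abelian surface; the graph of a CM endomorphism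

Layer `Literature/Geometry/Kaehler`, namespace `Literature.Geometry.Kaehler.ComplexTorus`; lane `lit-hodgefound`,
seat p07 (generation 48), programme «THE CONE OF CURVES OF AN ABELIAN SURFACE», file 71 of the seat lineage; sequel
of file 70 (`ComplexTorusEllipticSelfProductConeOfCurves`: the curves `F₁ = {0} × E`, `F₂ = E × {0}`, `Δ`, `Γ_n` of the
Euclidean self-product `E × E`, `F₁ · F₂ = F₁ · Δ = F₂ · Δ = 1`, `#(Γ_A ∩ Γ_B) = # ker ρ(A − B)`, the closed cone
`NE̅(E × E)`), of file 69 §1 (the closed positive nappe does not depend on the interior class: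
`intersectionForm_nonneg_iff_of_self_nonneg`, and the Hodge index `intersectionForm_self_neg_of_orthogonal_of_self_pos`),
of file 62 (`semipos_iff_intersectionForm_nonneg`: nef `⟺ Q(θ, θ) ≥ 0 ∧ Q(θ, η) ≥ 0`), of the tree's Kleiman lemma
(`IsRiemannForm.pos_iff_exists_pos_semipos_sub_smul`, `ComplexTorusAmpleConeNefConeInterior`), of file 66
(`SubtorusFrame.intersectionForm_eq_natCard_of_analyticCycleClass_eq`: `Q(θ_C, θ_C') = #(C ∩ C')`), file 68
(`SubtorusFrame.intersectionForm_pos_of_analyticCycleClass_eq`: `(C · η) > 0`) and of the endomorphism ring of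
`E_τ = ℂ/(ℤτ + ℤ)` (`ellipticEnd`, `ellipticEndEquiv`, `natCard_ker_eq_normSq : # ker [α] = |α|²`,
`ComplexTorusEllipticCurveEndomorphismRing` / `…Automorphisms`), all consumed BY NAME.  Theorems only (no
definition, no named fact, no instance, no notation; net debt `0`).

THE SOURCE, VERBATIM.  Th. Bauer, C. Schulz, *Seshadri constants on the self-product of an elliptic curve*, J. Algebra
320 (2008) 2981–3005 [held text `paper:doi-10-1016-j-jalgebra-2008-06-024`], §2 [p. 2985 = p0005 L9–L31]: "Let `E`
be an elliptic curve without complex multiplication. The abelian surface `X = E × E` is then of Picard number `3`,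
and the Néron–Severi group is generated over `ℤ` by the fibers `F₁, F₂` of the projections `X → E` and the diagonal
`Δ` (see [5, Section 2.7]). A line bundle `L = 𝒪_X(a₁F₁ + a₂F₂ + a₃Δ)` is ample if and only if its the integer
coefficients `a₁, a₂, a₂` satisfy the following inequalities: `a₁ + a₂ > 0, a₂ + a₃ > 0, a₃ + a₁ > 0,
a₁a₂ + a₂a₃ + a₃a₁ > 0. (2.0.1)` In fact, if `L` is ample then its intersections with the curves `F₁, F₂, Δ`, as
well as its selfintersection must be positive, which shows that the inequalities are necessary. Conversely, if the
inequalities are satisfied, then `L² > 0` and the intersection of `L` with the ample line bundle `𝒪_X(F₁ + F₂)` is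
positive, which implies that `L` is ample (see [15, 4.3.2(b)])." and "as `L · F₁ = a₂ + a₃`, `L · F₂ = a₁ + a₃`, and
`L · Δ = a₁ + a₂`"; §4.1 [pp. 2994–2995 = p0014 L70–p0015 L17]: "`E₁ = ℂ/ℤ + iℤ` … The Néron–Severi group of
`E₁ × E₁` is of rank four, with generators `F₁, F₂, Δ, Σ`, where `F₁, F₂` are the fibers of the projections, `Δ` is
the diagonal, and `Σ` is the graph of the automorphism `ι : E₁ → E₁, [x] ↦ [ix]` … Note that `ι` has exactly two
fixed-points: `[0]` and `[(1+i)/2]`. Therefore we have `Δ · Σ = 2`. As for the remaining intersection numbers, we get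
`F₁² = F₂² = Δ² = Σ² = 0` and `F₁ · F₂ = F₁ · Δ = F₂ · Δ = F₁ · Σ = F₂ · Σ = 1`."; §4.2 [p. 3001 = p0021 L20–L33]:
"`E₂ = ℂ/ℤ + e^{πi/3}ℤ` … The automorphism `σ` has the point `[0]` as its only fixed point. The fibers `F₁, F₂`,
the diagonal `Δ`, and the graph `Σ` of `σ` generate the Néron–Severi group of `X`, and they have the intersection
numbers `F₁² = F₂² = Δ² = Σ² = 0` and `F₁ · F₂ = F₁ · Δ = F₂ · Δ = F₁ · Σ = F₂ · Σ = Δ · Σ = 1`."  J. Kollár,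
S. Mori, *Birational Geometry of Algebraic Varieties* (1998), II.4 Cor. 1.21 [held text p0020]: "`Q⁺ := {z ∈ Q :
(z · H) > 0}` … `Q⁺ ⊂ NE̅(X)`" and Ex. 1.23 (2) [p0021]: "`NE̅(A) = Q̅⁺`" for an abelian surface.

THE MODEL is that of files 59–70 (`A = E/Φ(ℤ^ι)` a two-dimensional complex torus, `η` a Riemann form, `e` a
positively oriented enumeration of the lattice basis, `Q = intersectionForm Φ e`, a class `θ ∈ NS_ℝ(A)` is POSITIVE —
Kähler, i.e. AMPLE when integral (`IsRiemannForm` = `(1,1)` + integral + positive) — when its hermitian form is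
positive definite, `∀ v ≠ 0, θ(iv, v) > 0`; `X = E × E` is the Euclidean self-product `prodPeriodL2 Ψ Ψ` of a
one-dimensional torus `E = F/Ψ(ℤ^κ)`, `φ = prodHomeomorphL2 Ψ Ψ`, `F₁ = {t | (φ t).1 = 0}`, `F₂ = {t | (φ t).2 = 0}`,
`Δ = {t | (φ t).2 = (φ t).1}`, `Σ_A = Γ_A = {t | (φ t).2 = ρ(A)(φ t).1}` the graph of the endomorphism `ρ(A)`;
`θ_C` is THE Néron–Severi class of the curve `C` — `[C]_e = c₁(θ_C) = ofRealForm (-θ_C)`, unique by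
`ofRealForm_injective`).

* §1 THE OPEN POSITIVE CONE (any abelian surface).  **`IsRiemannForm.pos_iff_intersectionForm_self_pos_and_pos`**
  (`θ ∈ NS_ℝ(A)` is positive iff `Q(θ, θ) > 0 ∧ Q(θ, η) > 0`: Kleiman's `θ - εη` nef for small `ε` plus file 62's
  description of the nef cone), `IsRiemannForm.isRiemannForm_iff_intersectionForm_self_pos_and_pos` (integral
  classes: `L` ample iff `L² > 0 ∧ L · H > 0`), **`intersectionForm_pos_iff_of_self_pos`** (for `Q(α, α) > 0` the
  sign of `Q(α, ·)` is the same against `η` and against any `(1,1)`-class `h` with `h² > 0`, `h · η > 0`).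
* §2 BAUER–SCHULZ (2.0.1) (any elliptic curve `E`, `dim_ℂ F = 1`; `Z₀, Z₁, Z₂` sub-torus data presenting
  `F₁, F₂, Δ` through `0`, `θ₀, θ₁, θ₂` the Néron–Severi classes of any of their translates):
  `intersectionForm_fibres_diagonal_prodPeriodL2_self` (the Gram matrix `[[0,1,1],[1,0,1],[1,1,0]]`),
  `intersectionForm_smul_add_prodPeriodL2_self` (`L² = 2(xy + yz + zx)`, `L · F₁ = y + z`, `L · F₂ = z + x`,
  `L · Δ = x + y` for `L = xθ₀ + yθ₁ + zθ₂`), **`pos_smul_add_prodPeriodL2_self_iff`** (`L` positive iff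
  `x + y > 0 ∧ y + z > 0 ∧ z + x > 0 ∧ xy + yz + zx > 0`, real coefficients),
  **`isRiemannForm_smul_add_prodPeriodL2_self_iff`** ((2.0.1) AS PRINTED: `a₁θ₀ + a₂θ₁ + a₃θ₂`, `aᵢ ∈ ℤ`, is a
  polarisation iff `a₁ + a₂ > 0, a₂ + a₃ > 0, a₃ + a₁ > 0, a₁a₂ + a₂a₃ + a₃a₁ > 0`).  No hypothesis on `End(E)` is
  needed for this three-parameter family (without complex multiplication it exhausts `NS(E × E) ⊗ ℝ`, file 70 §3).
* §3 THE GRAPH OF AN ENDOMORPHISM (tables of §4.1–§4.2).  `natCard_setOf_snd_eq_fst_inter_setOf_graph`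
  (`#(Δ ∩ Σ_A) = |det(1 − A)|`), `natCard_setOf_snd_eq_zero_inter_setOf_graph` (`#(F₂ ∩ Σ_A) = |det A|`),
  `natCard_setOf_fst_eq_zero_inter_setOf_graph` (`#(F₁ ∩ Σ_A) = 1`) on any `E × E`; on `E_τ × E_τ`
  (`E_τ = ℂ/(ℤτ + ℤ)`, `A ∈ End(E_τ)` with analytic representation `α = ρ_a(A) ∈ ℛ`):
  `exists_mem_endRingInt_ellipticEndEquiv_eq`, **`natCard_setOf_snd_eq_fst_inter_setOf_graph_ellipticPeriod`**
  (`#(Δ ∩ Σ_α) = |1 − α|²`, the number of fixed points of `[α]`), `natCard_setOf_snd_eq_zero_inter_setOf_graph_ellipticPeriod`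
  (`#(F₂ ∩ Σ_α) = |α|²`), **`natCard_inter_graph_ellipticPeriod_of_eq_I`** (§4.1: `α = i` ⟹
  `F₁ · Σ = F₂ · Σ = 1`, `Δ · Σ = 2`), **`natCard_inter_graph_ellipticPeriod_of_eq_exp`** (§4.2: `α = e^{πi/3}` ⟹
  `F₁ · Σ = F₂ · Σ = Δ · Σ = 1`), `I_mem_ellipticEnd` (`i ∈ End(ℂ/(ℤi + ℤ))`), `exp_mem_ellipticEnd`
  (`e^{πi/3} ∈ End(ℂ/(ℤe^{πi/3} + ℤ))`).

Scope / TODO(general form): the four-generator ample criteria of §4.1 / §4.2 (`ρ = 4`) need the four-class analogue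
of file 69 and are not formalised; here only their intersection tables are.  The intersection numbers of §3 are the
set-theoretic counts `#(C ∩ C')` of file 66 (`= (C · C')` for elliptic curves through `0`,
`SubtorusFrame.intersectionForm_eq_natCard_of_analyticCycleClass_eq`).

## References

* [BauerSchulz2008] Th. Bauer, C. Schulz, *Seshadri constants on the self-product of an elliptic curve*, J. Algebra
  320 (2008) 2981–3005, §2 (2.0.1) (p. 2985), §4.1 (pp. 2994–2995), §4.2 (p. 3001).
* [KollarMori1998] J. Kollár, S. Mori, *Birational Geometry of Algebraic Varieties*, Cambridge Tracts in Math. 134,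
  CUP 1998, Ch. II §4 Cor. 1.21, Example 1.23 (2) (held copy pp. 20–21).
* [Lange2023AbelianVarietiesComplex] H. Lange, *Abelian Varieties over the Complex Numbers*, Springer 2023, §2.2
  Cor. 2.2.3 (Nakai–Moishezon), §1.1.2 Prop. 1.1.6, Prop. 1.1.13 (`deg ρ(A) = |det A|`).
* [Hartshorne1977] R. Hartshorne, *Algebraic Geometry*, GTM 52, Springer 1977, Ch. IV Exercise 4.11 (a)
  (`deg [α] = |α|²`).
* [SilvermanAEC2009] J. H. Silverman, *The Arithmetic of Elliptic Curves*, GTM 106, Ch. VI Thm. 5.5 (proof: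
  `End(E_τ) = {α : αΛ ⊆ Λ}`).
* [LangeBirkenhake1992] H. Lange, Ch. Birkenhake, *Complex Abelian Varieties* (1992), §1.1.2, §5.3.
-/

noncomputable section

set_option maxSynthPendingDepth 3

open scoped Manifold ComplexOrder NNReal InnerProductSpace Pointwise
open Complex Set Function Module Filter Topology WithLp

namespace Literature.Geometry.Kaehler

namespace ComplexTorus

universe u

/-! ### §1 The open positive cone of an abelian surface: `θ > 0 ⟺ Q(θ, θ) > 0 ∧ Q(θ, η) > 0` -/

section OpenCone

variable {ι : Type*} [Fintype ι] [DecidableEq ι] {E : Type u} [NormedAddCommGroup E] [InnerProductSpace ℂ E]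
  [FiniteDimensional ℂ E] (Φ : (ι → ℝ) ≃L[ℝ] E) (e : Fin (2 * 2) ≃ ι)

omit [FiniteDimensional ℂ E] in
/-- **The open Nakai–Moishezon criterion on an abelian surface / Kollár–Mori's `Q⁺` is the ample cone**: for a
polarisation `η` of a two-dimensional complex torus and a class `θ ∈ NS_ℝ(A)`, the hermitian form of `θ` is positive
definite (`θ` is a Kähler class, i.e. ample when integral) iff `Q(θ, θ) > 0` and `Q(θ, η) > 0`.  (`⟹`: `θ - εη` is
nef for small `ε > 0` (Kleiman), so `Q(θ - εη, θ - εη) ≥ 0`, `Q(θ - εη, η) ≥ 0`, and `Q(η, η) > 0`; `⟸`: for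
`ε ≤ Q(θ, η)/Q(η, η)` and `ε ≤ Q(θ, θ)/(2 Q(θ, η))` the class `θ - εη` lies in `Q̅⁺`, hence is nef (file 62), hence
`θ = (θ - εη) + εη` is positive.) [cite: KollarMori1998, §II.4 Cor. 1.21 (`Q⁺ = {z² > 0, z · H > 0} ⊂ NE̅(X)`; for an abelian surface `NE̅ = Q̅⁺`, Ex. 1.23 (2))]
[cite: BauerSchulz2008, §2 after (2.0.1) ("if the inequalities are satisfied, then `L² > 0` and the intersection of `L` with the ample line bundle … is positive, which implies that `L` is ample (see [15, 4.3.2(b)])")]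
[cite: Lange2023AbelianVarietiesComplex, §2.2 Cor. 2.2.3 (Nakai–Moishezon for abelian varieties)] -/
theorem IsRiemannForm.pos_iff_intersectionForm_self_pos_and_pos {η θ : E [⋀^Fin 2]→L[ℝ] ℝ} (hη : IsRiemannForm Φ η)
    (hθ : θ ∈ Submodule.span ℝ {α : E [⋀^Fin 2]→L[ℝ] ℝ | IsNSForm Φ α}) :
    (∀ v : E, v ≠ 0 → 0 < θ ![I • v, v]) ↔
      0 < intersectionForm (g := 2) Φ e θ θ ∧ 0 < intersectionForm (g := 2) Φ e θ η := by
  have h11 := hη.1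
  have hpos := hη.2.2
  have hθ11 : ∀ u v : E, θ ![I • u, I • v] = θ ![u, v] := type_one_one_of_mem_span_isNSForm Φ hθ
  have ha : 0 < intersectionForm (g := 2) Φ e η η :=
    _root_.Literature.Geometry.Hyperkaehler.ComplexTorus.intersectionForm_self_pos_of_pos Φ h11 hpos e
  have hsub11 : ∀ ε : ℝ, ∀ u v : E, (θ - ε • η) ![I • u, I • v] = (θ - ε • η) ![u, v] := fun ε u v ↦ by
    simp only [ContinuousAlternatingMap.sub_apply, ContinuousAlternatingMap.smul_apply, hθ11, h11]
  -- `Q(θ - εη, θ - εη) = Q(θ,θ) - 2ε Q(θ,η) + ε² Q(η,η)`, `Q(θ - εη, η) = Q(θ,η) - ε Q(η,η)`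
  have hQ1 : ∀ ε : ℝ, intersectionForm (g := 2) Φ e (θ - ε • η) (θ - ε • η) =
      intersectionForm (g := 2) Φ e θ θ - 2 * ε * intersectionForm (g := 2) Φ e θ η +
        ε ^ 2 * intersectionForm (g := 2) Φ e η η := fun ε ↦ by
    have hs : intersectionForm (g := 2) Φ e η θ = intersectionForm (g := 2) Φ e θ η := intersectionForm_comm Φ even_two e _ _
    simp only [map_sub, map_smul, LinearMap.sub_apply, LinearMap.smul_apply, smul_eq_mul, hs]
    ring
  have hQ2 : ∀ ε : ℝ, intersectionForm (g := 2) Φ e (θ - ε • η) η =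
      intersectionForm (g := 2) Φ e θ η - ε * intersectionForm (g := 2) Φ e η η := fun ε ↦ by
    simp only [map_sub, map_smul, LinearMap.sub_apply, LinearMap.smul_apply, smul_eq_mul]
  rw [hη.pos_iff_exists_pos_semipos_sub_smul Φ hθ]
  constructor
  · rintro ⟨ε, hε, hsp⟩
    obtain ⟨hq1, hq2⟩ := (semipos_iff_intersectionForm_nonneg Φ e h11 hpos (hsub11 ε)).1 hsp
    rw [hQ1] at hq1
    rw [hQ2] at hq2
    constructor
    · nlinarith [mul_pos hε ha, mul_pos (mul_pos hε hε) ha]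
    · nlinarith [mul_pos hε ha]
  · rintro ⟨hθθ, hθη⟩
    set a := intersectionForm (g := 2) Φ e η η with ha_def
    set p := intersectionForm (g := 2) Φ e θ η with hp_def
    set q := intersectionForm (g := 2) Φ e θ θ with hq_def
    set ε := min (p / a) (q / (2 * p)) with hε_def
    have hε : 0 < ε := lt_min (div_pos hθη ha) (div_pos hθθ (by positivity))
    have hε1 : ε ≤ p / a := min_le_left _ _
    have hε2 : ε ≤ q / (2 * p) := min_le_right _ _
    refine ⟨ε, hε, (semipos_iff_intersectionForm_nonneg Φ e h11 hpos (hsub11 ε)).2 ⟨?_, ?_⟩⟩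
    · rw [hQ1]
      have h1 : ε * a ≤ p := by rwa [le_div_iff₀ ha] at hε1
      have h2 : ε * (2 * p) ≤ q := by rwa [le_div_iff₀ (by positivity)] at hε2
      nlinarith [mul_pos hε ha, sq_nonneg ε]
    · rw [hQ2]
      have h1 : ε * a ≤ p := by rwa [le_div_iff₀ ha] at hε1
      linarith

omit [FiniteDimensional ℂ E] in
/-- **… for an integral class: `θ ∈ NS(A)` is a polarisation iff `Q(θ, θ) > 0` and `Q(θ, η) > 0`** (`L` is ample
iff `L² > 0` and `L · H > 0`). [cite: KollarMori1998, §II.4 Cor. 1.21 and Ex. 1.23 (2)] [cite: BauerSchulz2008, §2 (the paragraph after (2.0.1))]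
[cite: Lange2023AbelianVarietiesComplex, §2.2 Cor. 2.2.3] -/
theorem IsRiemannForm.isRiemannForm_iff_intersectionForm_self_pos_and_pos {η θ : E [⋀^Fin 2]→L[ℝ] ℝ}
    (hη : IsRiemannForm Φ η) (hθ : IsNSForm Φ θ) :
    IsRiemannForm Φ θ ↔ 0 < intersectionForm (g := 2) Φ e θ θ ∧ 0 < intersectionForm (g := 2) Φ e θ η := by
  rw [← hη.pos_iff_intersectionForm_self_pos_and_pos Φ e (Submodule.subset_span hθ)]
  exact ⟨fun h ↦ h.2.2, fun h ↦ ⟨hθ.type_one_one, hθ.integral, h⟩⟩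

/-- **The open positive nappe `Q⁺` does not depend on the interior class selecting it**: for a `(1,1)`-form `α`
with `Q(α, α) > 0` on a two-dimensional complex torus with positive `(1,1)`-form `η`, and any `(1,1)`-form `h`
with `Q(h, h) > 0`, `Q(h, η) > 0`: `Q(α, η) > 0 ⟺ Q(α, h) > 0` (the closed version is file 69's
`intersectionForm_nonneg_iff_of_self_nonneg`; `Q(α, η) ≠ 0 ≠ Q(α, h)` by the Hodge index, since `Q(α, α) > 0`).
[cite: KollarMori1998, §II.4 Cor. 1.21 (the two components `Q⁺ = {(z · H) > 0}`, `Q⁻` of `Q = {(z²) > 0}`)]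
[cite: BauerSchulz2008, §2 after (2.0.1) (selecting the ample nappe by `𝒪_X(F₁ + F₂)`)] -/
theorem intersectionForm_pos_iff_of_self_pos {η h α : E [⋀^Fin 2]→L[ℝ] ℝ}
    (h11 : ∀ u v : E, η ![I • u, I • v] = η ![u, v]) (hpos : ∀ v : E, v ≠ 0 → 0 < η ![I • v, v])
    (hh : ∀ u v : E, h ![I • u, I • v] = h ![u, v]) (hhh : 0 < intersectionForm (g := 2) Φ e h h)
    (hhη : 0 < intersectionForm (g := 2) Φ e h η)
    (hα : ∀ u v : E, α ![I • u, I • v] = α ![u, v]) (hαα : 0 < intersectionForm (g := 2) Φ e α α) :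
    0 < intersectionForm (g := 2) Φ e α η ↔ 0 < intersectionForm (g := 2) Φ e α h := by
  have hα0 : α ≠ 0 := by
    rintro rfl
    simp only [map_zero, lt_self_iff_false] at hαα
  have hηη : 0 < intersectionForm (g := 2) Φ e η η :=
    _root_.Literature.Geometry.Hyperkaehler.ComplexTorus.intersectionForm_self_pos_of_pos Φ h11 hpos e
  -- `Q(α, η) ≠ 0` and `Q(α, h) ≠ 0`: otherwise the Hodge index would give `Q(α, α) < 0`
  have hne_η : intersectionForm (g := 2) Φ e α η ≠ 0 := fun h0 ↦ by
    have := intersectionForm_self_neg_of_orthogonal_of_self_pos Φ e h11 hpos h11 hηη hα h0 hα0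
    linarith
  have hne_h : intersectionForm (g := 2) Φ e α h ≠ 0 := fun h0 ↦ by
    have := intersectionForm_self_neg_of_orthogonal_of_self_pos Φ e h11 hpos hh hhh hα h0 hα0
    linarith
  have hiff := intersectionForm_nonneg_iff_of_self_nonneg Φ e h11 hpos hh hhh hhη hα hαα.le
  constructor
  · intro hp
    exact lt_of_le_of_ne (hiff.1 hp.le) (Ne.symm hne_h)
  · intro hp
    exact lt_of_le_of_ne (hiff.2 hp.le) (Ne.symm hne_η)

end OpenCone

/-! ### §2 `E × E`: the Gram matrix of `F₁, F₂, Δ` and Bauer–Schulz's ample range (2.0.1) -/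

section AmpleCone

variable {κ : Type*} [Fintype κ] [DecidableEq κ] {F : Type u} [NormedAddCommGroup F] [InnerProductSpace ℂ F]
  [FiniteDimensional ℂ F] [MeasurableSpace F] [BorelSpace F] (Ψ : (κ → ℝ) ≃L[ℝ] F)
  (e : Fin (2 * 2) ≃ κ ⊕ κ) (he : orientationSign (prodPeriodL2 Ψ Ψ) e = 1)
  (Z₀ Z₁ Z₂ : SubtorusFrame (prodPeriodL2 Ψ Ψ) (2 * 1))
  (h₀ : Z₀.carrier 0 = {t | (prodHomeomorphL2 Ψ Ψ t).1 = 0})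
  (h₁ : Z₁.carrier 0 = {t | (prodHomeomorphL2 Ψ Ψ t).2 = 0})
  (h₂ : Z₂.carrier 0 = {t | (prodHomeomorphL2 Ψ Ψ t).2 = (prodHomeomorphL2 Ψ Ψ t).1}) (a₀ a₁ a₂ : WithLp 2 (F × F))
  {θ₀ θ₁ θ₂ : WithLp 2 (F × F) [⋀^Fin 2]→L[ℝ] ℝ}
  (hθ₀ : analyticCycleClass (prodPeriodL2 Ψ Ψ) e (show 2 * 1 + 2 * 1 = 2 * 2 from rfl) (Z₀.hasPureDim_carrier a₀) =
    ofRealForm (-θ₀))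
  (hθ₁ : analyticCycleClass (prodPeriodL2 Ψ Ψ) e (show 2 * 1 + 2 * 1 = 2 * 2 from rfl) (Z₁.hasPureDim_carrier a₁) =
    ofRealForm (-θ₁))
  (hθ₂ : analyticCycleClass (prodPeriodL2 Ψ Ψ) e (show 2 * 1 + 2 * 1 = 2 * 2 from rfl) (Z₂.hasPureDim_carrier a₂) =
    ofRealForm (-θ₂))

include he h₀ h₁ h₂ hθ₀ hθ₁ hθ₂ in
/-- **The Gram matrix of `F₁, F₂, Δ` on `E × E`: `F₁² = F₂² = Δ² = 0`, `F₁ · F₂ = F₁ · Δ = F₂ · Δ = 1`** for the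
Néron–Severi classes `θ₀, θ₁, θ₂` of (any translates of) `F₁ = {0} × E`, `F₂ = E × {0}`, `Δ` (`[C]_e = c₁(θ_C)`;
file 66: `Q(θ_C, θ_C') = #(C ∩ C')`, `Q(θ_C, θ_C) = 0`; file 70: the three intersections are `{0}`).
[cite: BauerSchulz2008, §2 ("`L · F₁ = a₂ + a₃, L · F₂ = a₁ + a₃, and L · Δ = a₁ + a₂`") and §4.1 ("`F₁² = F₂² = Δ² = 0`", "`F₁ · F₂ = F₁ · Δ = F₂ · Δ = 1`")] -/
theorem intersectionForm_fibres_diagonal_prodPeriodL2_self :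
    intersectionForm (g := 2) (prodPeriodL2 Ψ Ψ) e θ₀ θ₀ = 0 ∧ intersectionForm (g := 2) (prodPeriodL2 Ψ Ψ) e θ₁ θ₁ = 0 ∧
      intersectionForm (g := 2) (prodPeriodL2 Ψ Ψ) e θ₂ θ₂ = 0 ∧ intersectionForm (g := 2) (prodPeriodL2 Ψ Ψ) e θ₀ θ₁ = 1 ∧
        intersectionForm (g := 2) (prodPeriodL2 Ψ Ψ) e θ₀ θ₂ = 1 ∧ intersectionForm (g := 2) (prodPeriodL2 Ψ Ψ) e θ₁ θ₂ = 1 := by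
  refine ⟨Z₀.intersectionForm_self_eq_zero_of_analyticCycleClass_eq (prodPeriodL2 Ψ Ψ) e a₀ hθ₀,
    Z₁.intersectionForm_self_eq_zero_of_analyticCycleClass_eq (prodPeriodL2 Ψ Ψ) e a₁ hθ₁,
    Z₂.intersectionForm_self_eq_zero_of_analyticCycleClass_eq (prodPeriodL2 Ψ Ψ) e a₂ hθ₂, ?_, ?_, ?_⟩
  · rw [Z₀.intersectionForm_eq_natCard_of_analyticCycleClass_eq (prodPeriodL2 Ψ Ψ) e he Z₁ a₀ a₁ hθ₀ hθ₁, h₀, h₁,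
      Set.inter_comm, natCard_setOf_snd_eq_zero_inter_setOf_fst_eq_zero Ψ, Nat.cast_one]
  · rw [Z₀.intersectionForm_eq_natCard_of_analyticCycleClass_eq (prodPeriodL2 Ψ Ψ) e he Z₂ a₀ a₂ hθ₀ hθ₂, h₀, h₂,
      natCard_setOf_fst_eq_zero_inter_setOf_snd_eq_fst Ψ, Nat.cast_one]
  · rw [Z₁.intersectionForm_eq_natCard_of_analyticCycleClass_eq (prodPeriodL2 Ψ Ψ) e he Z₂ a₁ a₂ hθ₁ hθ₂, h₁, h₂,
      natCard_setOf_snd_eq_zero_inter_setOf_snd_eq_fst Ψ, Nat.cast_one]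

include he h₀ h₁ h₂ hθ₀ hθ₁ hθ₂ in
/-- **`L² = 2(xy + yz + zx)`, `L · F₁ = y + z`, `L · F₂ = z + x`, `L · Δ = x + y` for `L = xF₁ + yF₂ + zΔ` on `E × E`.**
[cite: BauerSchulz2008, §2 ("`L · F₁ = a₂ + a₃, L · F₂ = a₁ + a₃, and L · Δ = a₁ + a₂`"), §4.2 ("`2(a₁a₂ + …) = L² > 0`")] -/
theorem intersectionForm_smul_add_prodPeriodL2_self (x y z : ℝ) :
    intersectionForm (g := 2) (prodPeriodL2 Ψ Ψ) e (x • θ₀ + y • θ₁ + z • θ₂) (x • θ₀ + y • θ₁ + z • θ₂) =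
        2 * (x * y + y * z + z * x) ∧
      intersectionForm (g := 2) (prodPeriodL2 Ψ Ψ) e (x • θ₀ + y • θ₁ + z • θ₂) θ₀ = y + z ∧
      intersectionForm (g := 2) (prodPeriodL2 Ψ Ψ) e (x • θ₀ + y • θ₁ + z • θ₂) θ₁ = z + x ∧
      intersectionForm (g := 2) (prodPeriodL2 Ψ Ψ) e (x • θ₀ + y • θ₁ + z • θ₂) θ₂ = x + y := by
  obtain ⟨h00, h11', h22, h01, h02, h12⟩ :=
    intersectionForm_fibres_diagonal_prodPeriodL2_self Ψ e he Z₀ Z₁ Z₂ h₀ h₁ h₂ a₀ a₁ a₂ hθ₀ hθ₁ hθ₂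
  have h10 : intersectionForm (g := 2) (prodPeriodL2 Ψ Ψ) e θ₁ θ₀ = 1 := by rw [intersectionForm_comm _ even_two e, h01]
  have h20 : intersectionForm (g := 2) (prodPeriodL2 Ψ Ψ) e θ₂ θ₀ = 1 := by rw [intersectionForm_comm _ even_two e, h02]
  have h21 : intersectionForm (g := 2) (prodPeriodL2 Ψ Ψ) e θ₂ θ₁ = 1 := by rw [intersectionForm_comm _ even_two e, h12]
  simp only [map_add, map_smul, LinearMap.add_apply, LinearMap.smul_apply, smul_eq_mul, h00, h11', h22, h01, h02, h12,
    h10, h20, h21]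
  refine ⟨by ring, by ring, by ring, by ring⟩

omit [Fintype κ] [DecidableEq κ] [FiniteDimensional ℂ F] [MeasurableSpace F] [BorelSpace F] in
/-- The OPEN nappe of `{xy + yz + zx > 0}` containing the positive octant: selected by `x + y + z > 0` or by the three
pairwise sums. [cite: BauerSchulz2008, §2 (2.0.1)] -/
private theorem cone_open_nappe_iff₇₁ (x y z : ℝ) :
    (0 < x * y + y * z + z * x ∧ 0 < x + y + z) ↔
      (0 < x + y ∧ 0 < y + z ∧ 0 < z + x ∧ 0 < x * y + y * z + z * x) := by
  constructor
  · rintro ⟨hq, hs⟩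
    refine ⟨?_, ?_, ?_, hq⟩
    · by_contra h
      push Not at h
      nlinarith [sq_nonneg x, sq_nonneg y, sq_nonneg (x + y)]
    · by_contra h
      push Not at h
      nlinarith [sq_nonneg y, sq_nonneg z, sq_nonneg (y + z)]
    · by_contra h
      push Not at h
      nlinarith [sq_nonneg z, sq_nonneg x, sq_nonneg (z + x)]
  · rintro ⟨h1, h2, h3, hq⟩
    exact ⟨hq, by linarith⟩

include he h₀ h₁ h₂ hθ₀ hθ₁ hθ₂ in
/-- **BAUER–SCHULZ (2.0.1): THE AMPLE CONE OF `E × E`.**  On the self-product `X = E × E` of an elliptic curve, with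
`θ₀, θ₁, θ₂` the Néron–Severi classes of `F₁ = {0} × E`, `F₂ = E × {0}`, `Δ` (or any translates), the real class
`L = xθ₀ + yθ₁ + zθ₂` is positive (Kähler; ample when integral) if and only if
`x + y > 0, y + z > 0, z + x > 0, xy + yz + zx > 0` — equivalently `L · Δ > 0, L · F₁ > 0, L · F₂ > 0, L² > 0`.
Proof as printed: these numbers are `L · Δ, L · F₁, L · F₂, L²/2`, necessary since curves and `L²` pair positively
with an ample class; conversely `L² > 0` and `L · (F₁ + F₂ + Δ) = 2(x + y + z) > 0` put `L` in the open positive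
nappe `Q⁺`, which is the ample cone (§1; the interior class `F₁ + F₂ + Δ`, of square `6`, selects the same nappe as
the polarisation).  No hypothesis on `End(E)`: for `E` without complex multiplication these `L` are ALL classes
(`ρ = 3`, file 70); with complex multiplication they form the hyperplane `⟨F₁, F₂, Δ⟩ ⊂ NS_ℝ(E × E) ≅ ℝ⁴`.
[cite: BauerSchulz2008, §2 (2.0.1) ("A line bundle `L = 𝒪_X(a₁F₁ + a₂F₂ + a₃Δ)` is ample if and only if … `a₁ + a₂ > 0, a₂ + a₃ > 0, a₃ + a₁ > 0, a₁a₂ + a₂a₃ + a₃a₁ > 0`") with its proof]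
[cite: KollarMori1998, §II.4 Cor. 1.21 and Example 1.23 (2)] -/
theorem pos_smul_add_prodPeriodL2_self_iff (hF : finrank ℂ F = 1) (x y z : ℝ) :
    (∀ v : WithLp 2 (F × F), v ≠ 0 → 0 < (x • θ₀ + y • θ₁ + z • θ₂) ![I • v, v]) ↔
      0 < x + y ∧ 0 < y + z ∧ 0 < z + x ∧ 0 < x * y + y * z + z * x := by
  obtain ⟨η, hη⟩ := isAbelianVariety_prodPeriodL2_self Ψ hF
  have h11 := hη.1
  have hpos := hη.2.2
  -- the NS classes and their Gram data
  obtain ⟨θ₀', hNS₀, -, hcl₀, -, -⟩ :=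
    exists_isNSForm_re_analyticCyclePeriod_eq_intersectionForm (prodPeriodL2 Ψ Ψ) e he (Z₀.hasPureDim_carrier a₀)
  obtain ⟨θ₁', hNS₁, -, hcl₁, -, -⟩ :=
    exists_isNSForm_re_analyticCyclePeriod_eq_intersectionForm (prodPeriodL2 Ψ Ψ) e he (Z₁.hasPureDim_carrier a₁)
  obtain ⟨θ₂', hNS₂, -, hcl₂, -, -⟩ :=
    exists_isNSForm_re_analyticCyclePeriod_eq_intersectionForm (prodPeriodL2 Ψ Ψ) e he (Z₂.hasPureDim_carrier a₂)
  have e₀ : θ₀' = θ₀ := neg_injective (ofRealForm_injective (hcl₀.symm.trans hθ₀))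
  have e₁ : θ₁' = θ₁ := neg_injective (ofRealForm_injective (hcl₁.symm.trans hθ₁))
  have e₂ : θ₂' = θ₂ := neg_injective (ofRealForm_injective (hcl₂.symm.trans hθ₂))
  subst e₀ e₁ e₂
  set S := Submodule.span ℝ {α : WithLp 2 (F × F) [⋀^Fin 2]→L[ℝ] ℝ | IsNSForm (prodPeriodL2 Ψ Ψ) α} with hS
  set L := x • θ₀' + y • θ₁' + z • θ₂' with hL
  have hLS : L ∈ S :=
    S.add_mem (S.add_mem (S.smul_mem x (Submodule.subset_span hNS₀)) (S.smul_mem y (Submodule.subset_span hNS₁)))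
      (S.smul_mem z (Submodule.subset_span hNS₂))
  have hL11 : ∀ u v, L ![I • u, I • v] = L ![u, v] := type_one_one_of_mem_span_isNSForm (prodPeriodL2 Ψ Ψ) hLS
  -- the interior class `h = θ₀ + θ₁ + θ₂`: `Q(h, h) = 6`, `Q(h, η) > 0`
  set h := θ₀' + θ₁' + θ₂' with hh_def
  have hh1 : h = (1 : ℝ) • θ₀' + (1 : ℝ) • θ₁' + (1 : ℝ) • θ₂' := by simp only [one_smul, hh_def]
  have hhS : h ∈ S :=
    S.add_mem (S.add_mem (Submodule.subset_span hNS₀) (Submodule.subset_span hNS₁)) (Submodule.subset_span hNS₂)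
  have hh11 : ∀ u v, h ![I • u, I • v] = h ![u, v] := type_one_one_of_mem_span_isNSForm (prodPeriodL2 Ψ Ψ) hhS
  have hGh := intersectionForm_smul_add_prodPeriodL2_self Ψ e he Z₀ Z₁ Z₂ h₀ h₁ h₂ a₀ a₁ a₂ hθ₀ hθ₁ hθ₂ 1 1 1
  rw [← hh1] at hGh
  have hhh : 0 < intersectionForm (g := 2) (prodPeriodL2 Ψ Ψ) e h h := by rw [hGh.1]; norm_num
  have hhη : 0 < intersectionForm (g := 2) (prodPeriodL2 Ψ Ψ) e h η := by
    have p₀ := SubtorusFrame.intersectionForm_pos_of_analyticCycleClass_eq (prodPeriodL2 Ψ Ψ) e hη he Z₀ a₀ hθ₀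
    have p₁ := SubtorusFrame.intersectionForm_pos_of_analyticCycleClass_eq (prodPeriodL2 Ψ Ψ) e hη he Z₁ a₁ hθ₁
    have p₂ := SubtorusFrame.intersectionForm_pos_of_analyticCycleClass_eq (prodPeriodL2 Ψ Ψ) e hη he Z₂ a₂ hθ₂
    rw [hh_def, map_add, map_add, LinearMap.add_apply, LinearMap.add_apply]
    positivity
  -- `Q(L, L) = 2q`, `Q(L, h) = 2s`
  have hGL := intersectionForm_smul_add_prodPeriodL2_self Ψ e he Z₀ Z₁ Z₂ h₀ h₁ h₂ a₀ a₁ a₂ hθ₀ hθ₁ hθ₂ x y z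
  rw [← hL] at hGL
  have hLh : intersectionForm (g := 2) (prodPeriodL2 Ψ Ψ) e L h = 2 * (x + y + z) := by
    rw [hh_def, map_add, map_add, hGL.2.1, hGL.2.2.1, hGL.2.2.2]
    ring
  rw [hη.pos_iff_intersectionForm_self_pos_and_pos (prodPeriodL2 Ψ Ψ) e hLS, ← cone_open_nappe_iff₇₁]
  constructor
  · rintro ⟨hLL, hLη⟩
    have hLh' := (intersectionForm_pos_iff_of_self_pos (prodPeriodL2 Ψ Ψ) e h11 hpos hh11 hhh hhη hL11 hLL).1 hLη
    rw [hGL.1] at hLL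
    rw [hLh] at hLh'
    exact ⟨by linarith, by linarith⟩
  · rintro ⟨hq, hs⟩
    have hLL : 0 < intersectionForm (g := 2) (prodPeriodL2 Ψ Ψ) e L L := by rw [hGL.1]; linarith
    refine ⟨hLL, (intersectionForm_pos_iff_of_self_pos (prodPeriodL2 Ψ Ψ) e h11 hpos hh11 hhh hhη hL11 hLL).2 ?_⟩
    rw [hLh]
    linarith

include he h₀ h₁ h₂ hθ₀ hθ₁ hθ₂ in
/-- **BAUER–SCHULZ (2.0.1), AS PRINTED: `𝒪_X(a₁F₁ + a₂F₂ + a₃Δ)` is ample iff `a₁ + a₂ > 0, a₂ + a₃ > 0, a₃ + a₁ > 0,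
a₁a₂ + a₂a₃ + a₃a₁ > 0`** — the integral class `a₁θ₀ + a₂θ₁ + a₃θ₂ ∈ NS(E × E)` is a polarisation
(`IsRiemannForm`) exactly in Bauer–Schulz's range. [cite: BauerSchulz2008, §2 (2.0.1)] -/
theorem isRiemannForm_smul_add_prodPeriodL2_self_iff (hF : finrank ℂ F = 1) (a b c : ℤ) :
    IsRiemannForm (prodPeriodL2 Ψ Ψ) (a • θ₀ + b • θ₁ + c • θ₂) ↔
      0 < a + b ∧ 0 < b + c ∧ 0 < c + a ∧ 0 < a * b + b * c + c * a := by
  obtain ⟨θ₀', hNS₀, -, hcl₀, -, -⟩ :=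
    exists_isNSForm_re_analyticCyclePeriod_eq_intersectionForm (prodPeriodL2 Ψ Ψ) e he (Z₀.hasPureDim_carrier a₀)
  obtain ⟨θ₁', hNS₁, -, hcl₁, -, -⟩ :=
    exists_isNSForm_re_analyticCyclePeriod_eq_intersectionForm (prodPeriodL2 Ψ Ψ) e he (Z₁.hasPureDim_carrier a₁)
  obtain ⟨θ₂', hNS₂, -, hcl₂, -, -⟩ :=
    exists_isNSForm_re_analyticCyclePeriod_eq_intersectionForm (prodPeriodL2 Ψ Ψ) e he (Z₂.hasPureDim_carrier a₂)
  have e₀ : θ₀' = θ₀ := neg_injective (ofRealForm_injective (hcl₀.symm.trans hθ₀))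
  have e₁ : θ₁' = θ₁ := neg_injective (ofRealForm_injective (hcl₁.symm.trans hθ₁))
  have e₂ : θ₂' = θ₂ := neg_injective (ofRealForm_injective (hcl₂.symm.trans hθ₂))
  subst e₀ e₁ e₂
  have hNS : IsNSForm (prodPeriodL2 Ψ Ψ) (a • θ₀' + b • θ₁' + c • θ₂') := by
    have hm : a • θ₀' + b • θ₁' + c • θ₂' ∈ neronSeveriGroup (prodPeriodL2 Ψ Ψ) :=
      (neronSeveriGroup (prodPeriodL2 Ψ Ψ)).add_mem
        ((neronSeveriGroup (prodPeriodL2 Ψ Ψ)).add_mem ((neronSeveriGroup (prodPeriodL2 Ψ Ψ)).zsmul_mem hNS₀ a)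
          ((neronSeveriGroup (prodPeriodL2 Ψ Ψ)).zsmul_mem hNS₁ b))
        ((neronSeveriGroup (prodPeriodL2 Ψ Ψ)).zsmul_mem hNS₂ c)
    exact hm
  have hreal : a • θ₀' + b • θ₁' + c • θ₂' = (a : ℝ) • θ₀' + (b : ℝ) • θ₁' + (c : ℝ) • θ₂' := by
    simp only [Int.cast_smul_eq_zsmul]
  have key := pos_smul_add_prodPeriodL2_self_iff Ψ e he Z₀ Z₁ Z₂ h₀ h₁ h₂ a₀ a₁ a₂ hθ₀ hθ₁ hθ₂ hF (a : ℝ) b c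
  constructor
  · intro h
    have hp := h.2.2
    rw [hreal] at hp
    obtain ⟨h1, h2, h3, h4⟩ := key.1 hp
    exact ⟨by exact_mod_cast h1, by exact_mod_cast h2, by exact_mod_cast h3, by exact_mod_cast h4⟩
  · rintro ⟨h1, h2, h3, h4⟩
    refine ⟨hNS.type_one_one, hNS.integral, ?_⟩
    rw [hreal]
    exact key.2 ⟨by exact_mod_cast h1, by exact_mod_cast h2, by exact_mod_cast h3, by exact_mod_cast h4⟩

end AmpleCone

/-! ### §3 Complex multiplication: the graph `Σ_α` of an endomorphism and Bauer–Schulz's tables of §4.1–§4.2 -/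

section Graphs

variable {κ : Type*} [Fintype κ] [DecidableEq κ] {F : Type u} [NormedAddCommGroup F] [NormedSpace ℂ F]
  (Ψ : (κ → ℝ) ≃L[ℝ] F)

omit [DecidableEq κ] in
/-- `ρ(0) = 0` on points. [cite: LangeBirkenhake1992, §1.1.2] -/
private theorem mapMatrix_zero₇₁ (s : ComplexTorus Ψ) : mapMatrix Ψ Ψ (0 : Matrix κ κ ℤ) s = 0 := by
  funext i
  simp only [mapMatrix_apply, Matrix.zero_apply, zero_smul, Finset.sum_const_zero]
  rfl

/-- **`Δ · Σ_A = # ker ρ(1 − A) = |det(1 − A)|`** — the diagonal meets the graph `Σ_A = {(s, ρ(A)s)}` of an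
endomorphism `ρ(A)` of `E` exactly over the fixed points of `ρ(A)`. [cite: BauerSchulz2008, §4.1 ("`ι` has exactly two fixed-points … Therefore we have `Δ · Σ = 2`") and §4.2 ("`σ` has the point `[0]` as its only fixed point")]
[cite: Lange2023AbelianVarietiesComplex, §1.1.2 Prop. 1.1.13 (`#ker ρ(B) = |det B|`)] -/
theorem natCard_setOf_snd_eq_fst_inter_setOf_graph (A : Matrix κ κ ℤ) :
    Nat.card ↥({t : ComplexTorus (prodPeriodL2 Ψ Ψ) | (prodHomeomorphL2 Ψ Ψ t).2 = (prodHomeomorphL2 Ψ Ψ t).1} ∩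
      {t | (prodHomeomorphL2 Ψ Ψ t).2 = mapMatrix Ψ Ψ A (prodHomeomorphL2 Ψ Ψ t).1}) = (1 - A).det.natAbs := by
  have h := natCard_setOf_graph_inter_setOf_graph Ψ Ψ (1 : Matrix κ κ ℤ) A
  simp only [mapMatrix_one] at h
  rw [h, natCard_ker_mapMatrixHom]

/-- **`F₂ · Σ_A = # ker ρ(A) = |det A| = deg ρ(A)`** — the horizontal fibre `E × {0}` meets the graph of `ρ(A)`
over its kernel. [cite: BauerSchulz2008, §4.1 ("`F₂ · Σ = 1`" for the automorphism `ι`)] [cite: Lange2023AbelianVarietiesComplex, §1.1.2 Prop. 1.1.13] -/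
theorem natCard_setOf_snd_eq_zero_inter_setOf_graph (A : Matrix κ κ ℤ) :
    Nat.card ↥({t : ComplexTorus (prodPeriodL2 Ψ Ψ) | (prodHomeomorphL2 Ψ Ψ t).2 = 0} ∩
      {t | (prodHomeomorphL2 Ψ Ψ t).2 = mapMatrix Ψ Ψ A (prodHomeomorphL2 Ψ Ψ t).1}) = A.det.natAbs := by
  have h := natCard_setOf_graph_inter_setOf_graph Ψ Ψ (0 : Matrix κ κ ℤ) A
  simp only [mapMatrix_zero₇₁] at h
  rw [h, zero_sub, natCard_ker_mapMatrixHom, Matrix.det_neg, Int.natAbs_mul, Int.natAbs_pow, Int.natAbs_neg,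
    Int.natAbs_one, one_pow, one_mul]

omit [DecidableEq κ] in
/-- **`F₁ · Σ_A = 1`** — the vertical fibre `{0} × E` meets every graph exactly in the origin.
[cite: BauerSchulz2008, §4.1 ("`F₁ · Σ = 1`")] -/
theorem natCard_setOf_fst_eq_zero_inter_setOf_graph (A : Matrix κ κ ℤ) :
    Nat.card ↥({t : ComplexTorus (prodPeriodL2 Ψ Ψ) | (prodHomeomorphL2 Ψ Ψ t).1 = 0} ∩
      {t | (prodHomeomorphL2 Ψ Ψ t).2 = mapMatrix Ψ Ψ A (prodHomeomorphL2 Ψ Ψ t).1}) = 1 := by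
  rw [Set.inter_comm, setOf_graph_inter_setOf_fst_eq_zero, Nat.card_unique]

end Graphs

section EllipticCM

variable {τ : ℂ} (hτ : τ.im ≠ 0)

/-- Every `α ∈ ℛ = End(E_τ)` is the analytic representation of an integer matrix `A ∈ End(E_τ)`.
[cite: Lange2023AbelianVarietiesComplex, §1.1.2 Prop. 1.1.6] -/
theorem exists_mem_endRingInt_ellipticEndEquiv_eq {α : ℂ} (hα : α ∈ ellipticEnd hτ) :
    ∃ (A : Matrix (Fin 2) (Fin 2) ℤ) (hA : A ∈ endRingInt (ellipticPeriod hτ)),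
      ((ellipticEndEquiv hτ ⟨A, hA⟩ : ellipticEnd hτ) : ℂ) = α := by
  refine ⟨((ellipticEndEquiv hτ).symm ⟨α, hα⟩).1, ((ellipticEndEquiv hτ).symm ⟨α, hα⟩).2, ?_⟩
  rw [Subtype.coe_eta, RingEquiv.apply_symm_apply]

/-- **`Δ · Σ_α = |1 − α|²` on `E_τ × E_τ`**: the diagonal meets the graph of the endomorphism `[x] ↦ [αx]`
(`α = ρ_a(A) ∈ ℛ`) in `# ker(1 − [α]) = deg [1 − α] = |1 − α|²` points — the number of fixed points of `[α]`.
[cite: BauerSchulz2008, §4.1 ("`ι` has exactly two fixed-points: `[0]` and `[(1+i)/2]`. Therefore we have `Δ · Σ = 2`") and §4.2 ("The automorphism `σ` has the point `[0]` as its only fixed point … `Δ · Σ = 1`")]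
[cite: Hartshorne1977, Ch. IV Exercise 4.11 (a) (`deg [α] = |α|²`)] -/
theorem natCard_setOf_snd_eq_fst_inter_setOf_graph_ellipticPeriod {A : Matrix (Fin 2) (Fin 2) ℤ}
    (hA : A ∈ endRingInt (ellipticPeriod hτ)) :
    (Nat.card ↥({t : ComplexTorus (prodPeriodL2 (ellipticPeriod hτ) (ellipticPeriod hτ)) |
        (prodHomeomorphL2 (ellipticPeriod hτ) (ellipticPeriod hτ) t).2 =
          (prodHomeomorphL2 (ellipticPeriod hτ) (ellipticPeriod hτ) t).1} ∩
      {t | (prodHomeomorphL2 (ellipticPeriod hτ) (ellipticPeriod hτ) t).2 =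
        mapMatrix (ellipticPeriod hτ) (ellipticPeriod hτ) A (prodHomeomorphL2 (ellipticPeriod hτ) (ellipticPeriod hτ) t).1}) : ℝ) =
      Complex.normSq (1 - ((ellipticEndEquiv hτ ⟨A, hA⟩ : ellipticEnd hτ) : ℂ)) := by
  have h1A : 1 - A ∈ endRingInt (ellipticPeriod hτ) := Subring.sub_mem _ (Subring.one_mem _) hA
  have h := natCard_ker_eq_normSq hτ h1A
  rw [natCard_ker_mapMatrixHom] at h
  rw [natCard_setOf_snd_eq_fst_inter_setOf_graph, h]
  have hsub : (⟨1 - A, h1A⟩ : endRingInt (ellipticPeriod hτ)) = 1 - ⟨A, hA⟩ := rfl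
  rw [hsub, map_sub, map_one]
  rfl

/-- **`F₂ · Σ_α = |α|² = deg [α]`** on `E_τ × E_τ`. [cite: BauerSchulz2008, §4.1 ("`F₂ · Σ = 1`" for the automorphism `ι`)] [cite: Hartshorne1977, Ch. IV Exercise 4.11 (a)] -/
theorem natCard_setOf_snd_eq_zero_inter_setOf_graph_ellipticPeriod {A : Matrix (Fin 2) (Fin 2) ℤ}
    (hA : A ∈ endRingInt (ellipticPeriod hτ)) :
    (Nat.card ↥({t : ComplexTorus (prodPeriodL2 (ellipticPeriod hτ) (ellipticPeriod hτ)) |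
        (prodHomeomorphL2 (ellipticPeriod hτ) (ellipticPeriod hτ) t).2 = 0} ∩
      {t | (prodHomeomorphL2 (ellipticPeriod hτ) (ellipticPeriod hτ) t).2 =
        mapMatrix (ellipticPeriod hτ) (ellipticPeriod hτ) A (prodHomeomorphL2 (ellipticPeriod hτ) (ellipticPeriod hτ) t).1}) : ℝ) =
      Complex.normSq ((ellipticEndEquiv hτ ⟨A, hA⟩ : ellipticEnd hτ) : ℂ) := by
  have h := natCard_ker_eq_normSq hτ hA
  rw [natCard_ker_mapMatrixHom] at h
  rw [natCard_setOf_snd_eq_zero_inter_setOf_graph, h]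

/-- **BAUER–SCHULZ §4.1, the intersection table of `E₁ × E₁`, `E₁ = ℂ/(ℤ + iℤ)`**: for the graph `Σ` of complex
multiplication by `i` (`α = i`), `F₁ · Σ = F₂ · Σ = 1` and `Δ · Σ = |1 − i|² = 2`. [cite: BauerSchulz2008, §4.1 ("Note that `ι` has exactly two fixed-points … Therefore we have `Δ · Σ = 2`. … `F₁ · F₂ = F₁ · Δ = F₂ · Δ = F₁ · Σ = F₂ · Σ = 1`")] -/
theorem natCard_inter_graph_ellipticPeriod_of_eq_I {A : Matrix (Fin 2) (Fin 2) ℤ} (hA : A ∈ endRingInt (ellipticPeriod hτ))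
    (hi : ((ellipticEndEquiv hτ ⟨A, hA⟩ : ellipticEnd hτ) : ℂ) = I) :
    Nat.card ↥({t : ComplexTorus (prodPeriodL2 (ellipticPeriod hτ) (ellipticPeriod hτ)) |
        (prodHomeomorphL2 (ellipticPeriod hτ) (ellipticPeriod hτ) t).1 = 0} ∩
      {t | (prodHomeomorphL2 (ellipticPeriod hτ) (ellipticPeriod hτ) t).2 =
        mapMatrix (ellipticPeriod hτ) (ellipticPeriod hτ) A (prodHomeomorphL2 (ellipticPeriod hτ) (ellipticPeriod hτ) t).1}) = 1 ∧
    Nat.card ↥({t : ComplexTorus (prodPeriodL2 (ellipticPeriod hτ) (ellipticPeriod hτ)) |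
        (prodHomeomorphL2 (ellipticPeriod hτ) (ellipticPeriod hτ) t).2 = 0} ∩
      {t | (prodHomeomorphL2 (ellipticPeriod hτ) (ellipticPeriod hτ) t).2 =
        mapMatrix (ellipticPeriod hτ) (ellipticPeriod hτ) A (prodHomeomorphL2 (ellipticPeriod hτ) (ellipticPeriod hτ) t).1}) = 1 ∧
    Nat.card ↥({t : ComplexTorus (prodPeriodL2 (ellipticPeriod hτ) (ellipticPeriod hτ)) |
        (prodHomeomorphL2 (ellipticPeriod hτ) (ellipticPeriod hτ) t).2 =
          (prodHomeomorphL2 (ellipticPeriod hτ) (ellipticPeriod hτ) t).1} ∩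
      {t | (prodHomeomorphL2 (ellipticPeriod hτ) (ellipticPeriod hτ) t).2 =
        mapMatrix (ellipticPeriod hτ) (ellipticPeriod hτ) A (prodHomeomorphL2 (ellipticPeriod hτ) (ellipticPeriod hτ) t).1}) = 2 := by
  refine ⟨natCard_setOf_fst_eq_zero_inter_setOf_graph (ellipticPeriod hτ) A, ?_, ?_⟩
  · have h := natCard_setOf_snd_eq_zero_inter_setOf_graph_ellipticPeriod hτ hA
    rw [hi, Complex.normSq_I] at h
    exact_mod_cast h
  · have h := natCard_setOf_snd_eq_fst_inter_setOf_graph_ellipticPeriod hτ hA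
    rw [hi] at h
    have h2 : Complex.normSq (1 - I) = 2 := by simp [Complex.normSq_apply]; norm_num
    rw [h2] at h
    exact_mod_cast h

/-- **BAUER–SCHULZ §4.2, the intersection table of `E₂ × E₂`, `E₂ = ℂ/(ℤ + e^{πi/3}ℤ)`**: for the graph `Σ` of the
automorphism `σ : [x] ↦ [e^{πi/3} x]`, `F₁ · Σ = F₂ · Σ = Δ · Σ = 1` (`|1 − e^{πi/3}|² = 2 − 2cos(π/3) = 1`).
[cite: BauerSchulz2008, §4.2 ("The automorphism `σ` has the point `[0]` as its only fixed point. … `F₁ · F₂ = F₁ · Δ = F₂ · Δ = F₁ · Σ = F₂ · Σ = Δ · Σ = 1`")] -/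
theorem natCard_inter_graph_ellipticPeriod_of_eq_exp {A : Matrix (Fin 2) (Fin 2) ℤ} (hA : A ∈ endRingInt (ellipticPeriod hτ))
    (hσ : ((ellipticEndEquiv hτ ⟨A, hA⟩ : ellipticEnd hτ) : ℂ) = Complex.exp (↑(Real.pi / 3) * I)) :
    Nat.card ↥({t : ComplexTorus (prodPeriodL2 (ellipticPeriod hτ) (ellipticPeriod hτ)) |
        (prodHomeomorphL2 (ellipticPeriod hτ) (ellipticPeriod hτ) t).1 = 0} ∩
      {t | (prodHomeomorphL2 (ellipticPeriod hτ) (ellipticPeriod hτ) t).2 =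
        mapMatrix (ellipticPeriod hτ) (ellipticPeriod hτ) A (prodHomeomorphL2 (ellipticPeriod hτ) (ellipticPeriod hτ) t).1}) = 1 ∧
    Nat.card ↥({t : ComplexTorus (prodPeriodL2 (ellipticPeriod hτ) (ellipticPeriod hτ)) |
        (prodHomeomorphL2 (ellipticPeriod hτ) (ellipticPeriod hτ) t).2 = 0} ∩
      {t | (prodHomeomorphL2 (ellipticPeriod hτ) (ellipticPeriod hτ) t).2 =
        mapMatrix (ellipticPeriod hτ) (ellipticPeriod hτ) A (prodHomeomorphL2 (ellipticPeriod hτ) (ellipticPeriod hτ) t).1}) = 1 ∧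
    Nat.card ↥({t : ComplexTorus (prodPeriodL2 (ellipticPeriod hτ) (ellipticPeriod hτ)) |
        (prodHomeomorphL2 (ellipticPeriod hτ) (ellipticPeriod hτ) t).2 =
          (prodHomeomorphL2 (ellipticPeriod hτ) (ellipticPeriod hτ) t).1} ∩
      {t | (prodHomeomorphL2 (ellipticPeriod hτ) (ellipticPeriod hτ) t).2 =
        mapMatrix (ellipticPeriod hτ) (ellipticPeriod hτ) A (prodHomeomorphL2 (ellipticPeriod hτ) (ellipticPeriod hτ) t).1}) = 1 := by
  have hcos : (Complex.exp (↑(Real.pi / 3) * I)).re = 1 / 2 := by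
    rw [Complex.exp_ofReal_mul_I_re, Real.cos_pi_div_three]
  have hsin : (Complex.exp (↑(Real.pi / 3) * I)).im = Real.sqrt 3 / 2 := by
    rw [Complex.exp_ofReal_mul_I_im, Real.sin_pi_div_three]
  have hn1 : Complex.normSq (Complex.exp (↑(Real.pi / 3) * I)) = 1 := by
    rw [Complex.normSq_apply, hcos, hsin]
    have h3 : Real.sqrt 3 * Real.sqrt 3 = 3 := Real.mul_self_sqrt (by norm_num)
    nlinarith [h3]
  have hn2 : Complex.normSq (1 - Complex.exp (↑(Real.pi / 3) * I)) = 1 := by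
    rw [Complex.normSq_apply, Complex.sub_re, Complex.sub_im, Complex.one_re, Complex.one_im, hcos, hsin]
    have h3 : Real.sqrt 3 * Real.sqrt 3 = 3 := Real.mul_self_sqrt (by norm_num)
    nlinarith [h3]
  refine ⟨natCard_setOf_fst_eq_zero_inter_setOf_graph (ellipticPeriod hτ) A, ?_, ?_⟩
  · have h := natCard_setOf_snd_eq_zero_inter_setOf_graph_ellipticPeriod hτ hA
    rw [hσ, hn1] at h
    exact_mod_cast h
  · have h := natCard_setOf_snd_eq_fst_inter_setOf_graph_ellipticPeriod hτ hA
    rw [hσ, hn2] at h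
    exact_mod_cast h

/-- `i ∈ ℛ = End(E_i)`: the elliptic curve `ℂ/(ℤi + ℤ)` has complex multiplication by `i` (`i · 1 = i`,
`i · i = -1`). [cite: BauerSchulz2008, §4.1 ("`E₁ = ℂ/ℤ + iℤ`", the automorphism `ι : [x] ↦ [ix]`)]
[cite: SilvermanAEC2009, Ch. VI Thm. 5.5 (proof: `ℛ = {α : αΛ ⊆ Λ}`)] -/
theorem I_mem_ellipticEnd (hI : (I : ℂ).im ≠ 0) : I ∈ ellipticEnd hI :=
  (mem_ellipticEnd_iff hI).2 ⟨0, 1, -1, 0, by simp, by simp [Complex.I_mul_I]⟩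

/-- `e^{πi/3} ∈ ℛ = End(E_{e^{πi/3}})`: the elliptic curve `ℂ/(ℤ + e^{πi/3}ℤ)` has complex multiplication by the
sixth root of unity `ζ = e^{πi/3}` (`ζ · 1 = ζ`, `ζ · ζ = ζ − 1`). [cite: BauerSchulz2008, §4.2 ("`E₂ = ℂ/ℤ + e^{πi/3}ℤ`", the automorphism `σ : [x] ↦ [e^{πi/3}x]`)]
[cite: SilvermanAEC2009, Ch. VI Thm. 5.5 (proof)] -/
theorem exp_mem_ellipticEnd (hζ : (Complex.exp (↑(Real.pi / 3) * I)).im ≠ 0) :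
    Complex.exp (↑(Real.pi / 3) * I) ∈ ellipticEnd hζ := by
  have hcos : (Complex.exp (↑(Real.pi / 3) * I)).re = 1 / 2 := by
    rw [Complex.exp_ofReal_mul_I_re, Real.cos_pi_div_three]
  have hsin : (Complex.exp (↑(Real.pi / 3) * I)).im = Real.sqrt 3 / 2 := by
    rw [Complex.exp_ofReal_mul_I_im, Real.sin_pi_div_three]
  have h3 : Real.sqrt 3 * Real.sqrt 3 = 3 := Real.mul_self_sqrt (by norm_num)
  have hsq : Complex.exp (↑(Real.pi / 3) * I) * Complex.exp (↑(Real.pi / 3) * I) =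
      -1 + 1 * Complex.exp (↑(Real.pi / 3) * I) := by
    apply Complex.ext
    · simp only [Complex.mul_re, Complex.add_re, Complex.neg_re, Complex.one_re, one_mul, hcos, hsin]
      nlinarith [h3]
    · simp only [Complex.mul_im, Complex.add_im, Complex.neg_im, Complex.one_im, one_mul, hcos, hsin]
      ring
  refine (mem_ellipticEnd_iff hζ).2 ⟨0, 1, -1, 1, ?_, ?_⟩
  · rw [Int.cast_zero, Int.cast_one, zero_add, one_mul]
  · rw [Int.cast_neg, Int.cast_one]
    exact hsq

end EllipticCM

end ComplexTorus

end Literature.Geometry.Kaehler
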